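import Summits.HodgeConjecture.HodgeConjecture.Theses.BiquadraticSecantLift
import HarnessLib

/-!
# BiquadraticSecantLift · Assembly (stmt-HodgeConjecture-22135) — PROVED

The assembly item of route-HodgeConjecture-BiquadraticSecantLift,
`Assembly : MarkmanBiquadraticTwelvefolds → BiquadraticBaseChangeHyperbolic → BiquadraticWeilDescent → WeilSixfolds`,
is exactly the route's glue (`Theses.BiquadraticSecantLift.closes`, which slices `WeilSixfolds` by `d`, base-changes each
Weil-type sixfold `(A, φ)` to the hyperbolic twelvefold `(A ⊞ A, η_(d,m))` of X2, takes X1's algebraicity of the `L`-Weil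
classes there and descends with X3): `assembly_proof`.

State of the route after this file (for the record, not used here): X2 `BiquadraticBaseChangeHyperbolic` and X3
`BiquadraticWeilDescent` are theorems of the tree (`biquadraticBaseChangeHyperbolic_proof`, `biquadraticWeilDescent_proof`, in
`Theorems/BiquadraticSecantLiftBiquadraticBaseChangeHyperbolic`, `Theorems/BiquadraticSecantLiftBiquadraticWeilDescent`), so
`closes h1 biquadraticBaseChangeHyperbolic_proof biquadraticWeilDescent_proof : WeilSixfolds` for every
`h1 : MarkmanBiquadraticTwelvefolds` — the rung H2 is reduced to the OPEN crux X1 (Markman's secant-sheaf programme for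
`[L:ℚ] = 4`, `dim B = 12`). Nothing here proves X1, H2, or the Hodge conjecture.

## References
[cite: Deligne1982HodgeCycles, §4–§5] [cite: Markman2025SecantRealMultiplication, §1.1]
-/

-- every declaration of this problem lives in `Summit.HodgeConjecture.HodgeConjecture.…` (summit = sub-problem)
set_option linter.dupNamespace false

namespace Summit.HodgeConjecture.HodgeConjecture.BiquadraticSecantLift

open Summit.HodgeConjecture.HodgeConjecture.Theses.BiquadraticSecantLift

/-- **Assembly (stmt-HodgeConjecture-22135), proved**: the route's three cruxes imply the rung H2 `WeilSixfolds` — the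
route file's glue `closes`. HC / H2 are NOT proved by this theorem (it is an implication). -/
theorem assembly_proof : Summit.HodgeConjecture.HodgeConjecture.Theses.BiquadraticSecantLift.Assembly :=
  -- Proof-only re-glue (ops-buildfix, 2026-08-28): the route's `closes` was re-keyed at 06:34Z to the POLARIZED binders
  -- (X1pol `MarkmanBiquadraticTwelvefoldsPolarized`, X2pol `BiquadraticBaseChangePolarized`), so `closes h1 h2 h3` no longer
  -- typechecks against this (unchanged, closed) statement; the pre-edit glue is inlined verbatim with the hyperbolic
  -- projection `IsHyperbolicWeilTypeCM.isWeilTypeCM` in place of the polarized one. Statement byte-identical.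
  fun h1 h2 h3 =>
    Summit.HodgeConjecture.HodgeConjecture.WeilTypeLadder.weilSixfolds_of_forall_slice
      fun d hd A φ hA _hX hφ c hc h33 hcW => by
        by_cases hc0 : c = 0
        · rw [hc0]; exact Submodule.zero_mem _
        obtain ⟨m, hm, hsq, hH⟩ := h2 d hd A φ hA hφ ⟨c, hcW, hc0, h33⟩
        exact h3 d m hd hm hsq A φ hA hφ hH.isWeilTypeCM (h1 d m hd hm hsq (A ⊞ A) _ hH) c hc h33 hcW

end Summit.HodgeConjecture.HodgeConjecture.BiquadraticSecantLift
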